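import Summits.Ventures.AbcSig.Rows.XTemplateC2a
import Summits.Ventures.AbcSig.Levels.N311
import Summits.Ventures.AbcSig.Levels.N622
import Summits.Ventures.AbcSig.Levels.N622M6X

/-!
# Venture AbcSig — ROW `C2aL311A6`: `xⁿ + 2^a·311^m·yⁿ = z²`, class `a ≥ 6` (levels 311 (norm form) and 622 (tree)) — GENERATED by p-lean g4 `gen4/a6row.py`

HONEST FRAMING. A row of a COMPUTATION cell (`pub-abcsig`); a CONDITIONAL theorem, no claim on ABC or any summit.
Hypotheses: `BS04Package` (CITED); `DataComplete 311` + `RefinesCPSymAll 311` (COMPUTED: norm-form level file `Levels/N311.lean` built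
from the engine-1 characteristic polynomials — the big orbits of this prime level have no small-prime θ-coordinates, so the ordinary
ℤ[θ] certificates were never possible) and `DataComplete 622` (tree); `EisPackage` (CITED) + `Refines` (COMPUTED) for the module-M6 residue(s) of level 622 discharged IN THE KERNEL;
the listed per-orbit exclusions `hX_…` (CITED: the row of record's module closures). `a = 6` uses both levels (case (v₆)), `a ≥ 7` the
level 622 only. Exponent range: prime `n ≥ 11`, `n ≠ 311`; `6 ≤ a < n`, `1 ≤ m < n`.
Residual of record: none. CITED per the row of record's R3 at level 311: 311.2 @ 31: M6. Level 622 (tree): 622.4 @ 13: M6 — kernel M6 discharges 4:13 (Levels/N622M6X.lean).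
Row of record: `census/rows/C2a/C2a-l311-a6plus.md` (sha16 `403fa91909d1d74c`; SIGNED 2026-08-22T09:50:52Z by referee (ref-g5)).
-/

namespace Summit.Ventures.AbcSig

/-- Row `C2aL311A6`: class `a ≥ 6`, first distribution, prime `n ≥ 11`, `n ≠ 311`; conditional on the named hypotheses. -/
theorem xrow_C2aL311A6 (M : NewformModel) (hP : M.BS04Package)
    (hE : M.EisPackage)
    (hR_orbit_622_4 : M.Refines 622 orbit_622_4 m6X_622_4)
    (hD311 : M.DataComplete 311 level311Orbits) (hCP311 : M.RefinesCPSymAll 311 level311CP)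
    (hD622 : M.DataComplete 622 level622Orbits)
    (n : ℕ) (hn : n.Prime) (hmin : 11 ≤ n) (hnℓ : n ≠ 311) (a m : ℕ) (ha : 6 ≤ a) (hm : 1 ≤ m) (han : a < n) (hmn : m < n)
    (hX_orbit_311_2 : n ∈ ([31] : List ℕ) → M.Excludes 311 orbit_311_2 (famB (2 ^ a * 311 ^ m) n (fun _ _ => True)))
    (x y z : ℤ) (hxy1 : x * y ≠ 1) (hxy2 : x * y ≠ -1) : ¬ IsPrimitiveSolution 1 (2 ^ a * 311 ^ m) 1 n x y z := by
  have hℓ : Nat.Prime 311 := by norm_num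
  have h7 : 7 ≤ n := by omega
  have hS1 :=
    (level311_sieve M hP hCP311 n hn h7 (fun o => M.Excludes 311 o (famB (2 ^ a * 311 ^ m) n (fun _ _ => True)) ∨ M.ExcludesStd 311 o n) (fun _ h => Or.inr h) (fun hmem => by
      rcases (by simpa using hmem : n = 7 ∨ n = 31) with rfl | rfl
      · omega
      · exact Or.inl (hX_orbit_311_2 (by simp))))
  have hS2 :=
    (level622_sieve n hn h7 (fun o => M.Excludes 622 o (famB (2 ^ a * 311 ^ m) n (fun _ _ => True)) ∨ M.ExcludesStd 622 o n) (fun hmem => by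
      obtain rfl : n = 7 := by simpa using hmem
      omega) (fun hmem => by
      obtain rfl : n = 7 := by simpa using hmem
      omega) (fun hmem => by
      obtain rfl : n = 13 := by simpa using hmem
      exact Or.inr (m6c_622_4_n13_excludes M hE hR_orbit_622_4)))
  by_cases ha6 : a = 6
  · subst ha6
    exact xrowC2a_a6 311 hℓ (by norm_num) M hP n hn h7 hnℓ hD311 hD622 m hm hmn hS1 hS2 x y z hxy1 hxy2
  · exact xrowC2a_age7 311 hℓ (by norm_num) M hP n hn h7 hnℓ hD622 a m (by omega) hm han hmn hS2 x y z hxy1 hxy2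

end Summit.Ventures.AbcSig
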